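import Summits.QuantumFields.YangMills.Theorems.UnitScaleTiltProp7SectET3RealCoordSums
import HarnessLib

/-!
# `UnitScaleTiltProp7CombTranslateDefs` — THE LATTICE TRANSLATION `τ` OF ★★OWNER ym3-torus-plan g29 RULING №18 AS HILBERT LETTERS: the translation of the fine torus `T^{(0)}` by an integer
# vector `c ∈ ℤ³` on the route's gauge parameters and vector fields, read in `L²` through brick L0a's transports `toL2S ∕ toL2`, as LINEAR ISOMETRIC EQUIVALENCES `tauS c`, `tauB c`
(route `UnitScaleTilt`, crux K1 «MinimiserStabilityRegPr» stmt-QuantumFields-19200; RULING №18 (2) «identify comb∕S at the flat member by the lattice translation τ by `c·(1,1,1)`,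
`c = (L^{K−n}−1)∕2`»; item (b1) of px6 g5's LOCATE-COMBFLAT ADDENDUM (F*); DEFINITIONS, count-neutral).
Cell `ym3-torus` (HUMAN RULING D-0037, YM ladder rung R3 — YM₃ on T³ is a rung, not d = 4, not a mass gap, not Clay), width seat `ym3-torus-px6` (gen 5).

WHAT IS DEFINED (general integer vector `c`; the route's `c` is `halfBlockVec F n K := labels (basePt F n K)`):
* `siteTranslEquiv c : Site (F.P K) 0 ≃ Site (F.P K) 0` (`x ↦ transl x c`, inverse `transl · (−c)`), `bondTranslEquiv c : PBond (F.P K) 0 ≃ PBond (F.P K) 0` (`⟨x, μ⟩ ↦ ⟨transl x c, μ⟩`);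
* `siteTransl c`, `bondTransl c` — precomposition by them, as `ℂ`-linear equivalences of the route carriers (`LinearEquiv.funCongrLeft`): `(siteTransl c f) x = f (transl x c)`;
* ★ `tauS c : SiteL2K ℂ 3 (periodsT3 F K) c₀ W₂ ≃ₗᵢ[ℂ] SiteL2K …`, ★ `tauB c : BondL2K … ≃ₗᵢ[ℂ] BondL2K …` — the conjugates by `toL2S`∕`toL2` (isometries: the weighted `L²` sums are
  translation invariant, `inner_siteTransl`∕`inner_bondTransl`); `halfBlockVec F n K`.
Basic API: `siteTransl_apply`, `bondTransl_apply`, `bondTranslEquiv_tgt` (`(b + c)₊ = b₊ + c`), `tauS_toL2S`, `tauB_toL2`.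
HONEST FRAMING.  Letters only; the identification theorems (`NSc 1 = (NS 1).map (tauS c)`, `Rc 1 = tauS ∘ RS 1 ∘ tauS⁻¹`, commutation with `Δ^η(1)`, `D(1)`) are the (b1) proof files.
Nothing of COMB-FLAT COERCIVITY, HESS ∕ E′ ∕ EX ∕ the crux K1 is proved; rung R3, not Clay; YM gap NOT proved.  `--kind definition --supports stmt-QuantumFields-19200 --as helper`.
References: T. Bałaban, CMP 99 (1985) 389–434 [Balaban1985BackgroundPropagators] ((3.11) p.392, (3.21) p.394); CMP 109 (1987) 249–301 [Balaban1987RG1] ((0.1) p.251).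
-/

noncomputable section

open scoped InnerProductSpace Matrix.Norms.L2Operator BigOperators

namespace Summit.QuantumFields.YangMills.Theorems.Prop7CombTranslate

open Literature.MathematicalPhysics.QuantumFieldTheory.Balaban1983to89
open Literature.MathematicalPhysics.QuantumFieldTheory.Balaban1983to89.T3ContinuumYM3Torus
open B9Eq311L2Pairing (WL2)
open B11Eq103H1Complex (SiteL2K BondL2K)
open B10Eq27TorusAxialLog (transl transl_apply transl_add transl_zero transl_add_e)
open Summit.QuantumFields.YangMills.Theorems.Prop7SPrint (basePt)
open Summit.QuantumFields.YangMills.Theorems.Prop7SectET3Transport (periodsT3)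
open Summit.QuantumFields.YangMills.Theorems.Prop7SectET3HilbertLetters (W₂ toL2 toL2S inner_toL2)
open Summit.QuantumFields.YangMills.Theorems.Prop7SectET3RealCoordSums (inner_toL2S)

variable (F : T3Family) (K : ℕ)

/-! ## §1 Translations of the fine torus and of its bonds -/

/-- **translation of `T^{(0)}` by `c ∈ ℤ³`** as a permutation (`x ↦ x + c`, inverse `x ↦ x − c`). [cite: Balaban1987RG1, (0.1) p.251] -/
def siteTranslEquiv (c : B7Prop1Explicit.Site (F.P K).d) : Site (F.P K) 0 ≃ Site (F.P K) 0 where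
  toFun x := transl x c
  invFun x := transl x (-c)
  left_inv x := by show transl (transl x c) (-c) = x; rw [← transl_add, add_neg_cancel, transl_zero]
  right_inv x := by show transl (transl x (-c)) c = x; rw [← transl_add, neg_add_cancel, transl_zero]

/-- **translation of the positively oriented bonds of `T^{(0)}`**: `⟨x, μ⟩ ↦ ⟨x + c, μ⟩`. [cite: Balaban1987RG1, (0.1) p.251] -/
def bondTranslEquiv (c : B7Prop1Explicit.Site (F.P K).d) : PBond (F.P K) 0 ≃ PBond (F.P K) 0 where
  toFun b := ⟨transl b.src c, b.dir⟩
  invFun b := ⟨transl b.src (-c), b.dir⟩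
  left_inv b := by obtain ⟨x, μ⟩ := b; show (⟨transl (transl x c) (-c), μ⟩ : PBond (F.P K) 0) = ⟨x, μ⟩; rw [← transl_add, add_neg_cancel, transl_zero]
  right_inv b := by obtain ⟨x, μ⟩ := b; show (⟨transl (transl x (-c)) c, μ⟩ : PBond (F.P K) 0) = ⟨x, μ⟩; rw [← transl_add, neg_add_cancel, transl_zero]

variable {F K}

/-- unfolding. [cite: Balaban1987RG1, (0.1) p.251] -/
@[simp] theorem siteTranslEquiv_apply (c : B7Prop1Explicit.Site (F.P K).d) (x : Site (F.P K) 0) : siteTranslEquiv F K c x = transl x c := rfl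

/-- unfolding. [cite: Balaban1987RG1, (0.1) p.251] -/
@[simp] theorem bondTranslEquiv_apply_src (c : B7Prop1Explicit.Site (F.P K).d) (b : PBond (F.P K) 0) : (bondTranslEquiv F K c b).src = transl b.src c := rfl

/-- unfolding. [cite: Balaban1987RG1, (0.1) p.251] -/
@[simp] theorem bondTranslEquiv_apply_dir (c : B7Prop1Explicit.Site (F.P K).d) (b : PBond (F.P K) 0) : (bondTranslEquiv F K c b).dir = b.dir := rfl

/-- translation commutes with the lattice step: `(x + e_μ) + c = (x + c) + e_μ`. [cite: Balaban1987RG1, (0.1) p.251] -/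
theorem transl_shift (x : Site (F.P K) 0) (μ : Fin (F.P K).d) (c : B7Prop1Explicit.Site (F.P K).d) :
    transl (x.shift μ) c = (transl x c).shift μ := by
  have h1 : x.shift μ = transl x (B7Prop1Explicit.e μ) := by rw [← zero_add (B7Prop1Explicit.e μ), transl_add_e, transl_zero]
  rw [h1, ← transl_add, add_comm, transl_add_e]

/-- **`(b + c)₊ = b₊ + c`**: the translated bond ends at the translated end point. [cite: Balaban1987RG1, (0.1) p.251] -/
theorem bondTranslEquiv_tgt (c : B7Prop1Explicit.Site (F.P K).d) (b : PBond (F.P K) 0) :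
    (bondTranslEquiv F K c b).tgt = transl b.tgt c := by
  show (transl b.src c).shift b.dir = transl (b.src.shift b.dir) c
  rw [transl_shift]

variable (F K)

/-! ## §2 Translation of gauge parameters and of vector fields on the route carriers -/

/-- **translation of gauge parameters**: `(siteTransl c f)(x) = f(x + c)`, a `ℂ`-linear equivalence. [cite: Balaban1985BackgroundPropagators, p.393] -/
def siteTransl (c : B7Prop1Explicit.Site (F.P K).d) : (Site (F.P K) 0 → Matrix (Fin 2) (Fin 2) ℂ) ≃ₗ[ℂ] (Site (F.P K) 0 → Matrix (Fin 2) (Fin 2) ℂ) :=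
  LinearEquiv.funCongrLeft ℂ (Matrix (Fin 2) (Fin 2) ℂ) (siteTranslEquiv F K c)

/-- **translation of vector fields**: `(bondTransl c X)(b) = X(b + c)`. [cite: Balaban1985BackgroundPropagators, (3.11) p.392] -/
def bondTransl (c : B7Prop1Explicit.Site (F.P K).d) : (PBond (F.P K) 0 → Matrix (Fin 2) (Fin 2) ℂ) ≃ₗ[ℂ] (PBond (F.P K) 0 → Matrix (Fin 2) (Fin 2) ℂ) :=
  LinearEquiv.funCongrLeft ℂ (Matrix (Fin 2) (Fin 2) ℂ) (bondTranslEquiv F K c)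

variable {F K}

/-- unfolding. [cite: Balaban1985BackgroundPropagators, p.393] -/
@[simp] theorem siteTransl_apply (c : B7Prop1Explicit.Site (F.P K).d) (f : Site (F.P K) 0 → Matrix (Fin 2) (Fin 2) ℂ) (x : Site (F.P K) 0) :
    siteTransl F K c f x = f (transl x c) := rfl

/-- unfolding. [cite: Balaban1985BackgroundPropagators, (3.11) p.392] -/
@[simp] theorem bondTransl_apply (c : B7Prop1Explicit.Site (F.P K).d) (X : PBond (F.P K) 0 → Matrix (Fin 2) (Fin 2) ℂ) (b : PBond (F.P K) 0) :
    bondTransl F K c X b = X (bondTranslEquiv F K c b) := rfl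

/-! ## §3 The translations in `L²`: isometric equivalences `tauS`, `tauB` -/

variable {c₀ : ℝ} [Fact (0 < c₀)]

/-- the weighted site pairing is translation invariant. [cite: Balaban1985BackgroundPropagators, p.393] -/
theorem inner_siteTransl (c : B7Prop1Explicit.Site (F.P K).d) (l l' : Site (F.P K) 0 → Matrix (Fin 2) (Fin 2) ℂ) :
    ⟪toL2S F K c₀ (siteTransl F K c l), toL2S F K c₀ (siteTransl F K c l')⟫_ℂ = ⟪toL2S F K c₀ l, toL2S F K c₀ l'⟫_ℂ := by
  rw [inner_toL2S, inner_toL2S]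
  congr 1
  exact Fintype.sum_equiv (siteTranslEquiv F K c) _ _ fun x => rfl

/-- the weighted bond pairing is translation invariant. [cite: Balaban1985BackgroundPropagators, (3.11) p.392] -/
theorem inner_bondTransl (c : B7Prop1Explicit.Site (F.P K).d) (A B : PBond (F.P K) 0 → Matrix (Fin 2) (Fin 2) ℂ) :
    ⟪toL2 F K c₀ (bondTransl F K c A), toL2 F K c₀ (bondTransl F K c B)⟫_ℂ = ⟪toL2 F K c₀ A, toL2 F K c₀ B⟫_ℂ := by
  rw [inner_toL2, inner_toL2]
  congr 1
  exact Fintype.sum_equiv (bondTranslEquiv F K c) _ _ fun b => rfl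

variable (F K c₀)

/-- the translation of gauge parameters in `L²`, as a linear equivalence (conjugate of `siteTransl` by `toL2S`). [cite: Balaban1985BackgroundPropagators, p.393] -/
def tauSₗ (c : B7Prop1Explicit.Site (F.P K).d) : SiteL2K ℂ 3 (periodsT3 F K) c₀ W₂ ≃ₗ[ℂ] SiteL2K ℂ 3 (periodsT3 F K) c₀ W₂ :=
  ((toL2S F K c₀).symm.trans (siteTransl F K c)).trans (toL2S F K c₀)

/-- the translation of vector fields in `L²`, as a linear equivalence (conjugate of `bondTransl` by `toL2`). [cite: Balaban1985BackgroundPropagators, (3.11) p.392] -/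
def tauBₗ (c : B7Prop1Explicit.Site (F.P K).d) : BondL2K ℂ 3 (periodsT3 F K) c₀ W₂ ≃ₗ[ℂ] BondL2K ℂ 3 (periodsT3 F K) c₀ W₂ :=
  ((toL2 F K c₀).symm.trans (bondTransl F K c)).trans (toL2 F K c₀)

variable {F K c₀}

omit [Fact (0 < c₀)] in
/-- `tauSₗ c (toL2S f) = toL2S (f ∘ (· + c))`. [cite: Balaban1985BackgroundPropagators, p.393] -/
@[simp] theorem tauSₗ_toL2S (c : B7Prop1Explicit.Site (F.P K).d) (f : Site (F.P K) 0 → Matrix (Fin 2) (Fin 2) ℂ) :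
    tauSₗ F K c₀ c (toL2S F K c₀ f) = toL2S F K c₀ (siteTransl F K c f) := by
  simp [tauSₗ]

omit [Fact (0 < c₀)] in
/-- `tauBₗ c (toL2 X) = toL2 (X ∘ (· + c))`. [cite: Balaban1985BackgroundPropagators, (3.11) p.392] -/
@[simp] theorem tauBₗ_toL2 (c : B7Prop1Explicit.Site (F.P K).d) (X : PBond (F.P K) 0 → Matrix (Fin 2) (Fin 2) ℂ) :
    tauBₗ F K c₀ c (toL2 F K c₀ X) = toL2 F K c₀ (bondTransl F K c X) := by
  simp [tauBₗ]

/-- `tauSₗ` preserves the inner product. [cite: Balaban1985BackgroundPropagators, p.393] -/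
theorem inner_tauSₗ (c : B7Prop1Explicit.Site (F.P K).d) (x y : SiteL2K ℂ 3 (periodsT3 F K) c₀ W₂) :
    ⟪tauSₗ F K c₀ c x, tauSₗ F K c₀ c y⟫_ℂ = ⟪x, y⟫_ℂ := by
  obtain ⟨f, rfl⟩ := (toL2S F K c₀).surjective x
  obtain ⟨g, rfl⟩ := (toL2S F K c₀).surjective y
  rw [tauSₗ_toL2S, tauSₗ_toL2S, inner_siteTransl]

/-- `tauBₗ` preserves the inner product. [cite: Balaban1985BackgroundPropagators, (3.11) p.392] -/
theorem inner_tauBₗ (c : B7Prop1Explicit.Site (F.P K).d) (x y : BondL2K ℂ 3 (periodsT3 F K) c₀ W₂) :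
    ⟪tauBₗ F K c₀ c x, tauBₗ F K c₀ c y⟫_ℂ = ⟪x, y⟫_ℂ := by
  obtain ⟨A, rfl⟩ := (toL2 F K c₀).surjective x
  obtain ⟨B, rfl⟩ := (toL2 F K c₀).surjective y
  rw [tauBₗ_toL2, tauBₗ_toL2, inner_bondTransl]

variable (F K c₀)

/-- ★ **`τ_S(c)` — THE LATTICE TRANSLATION ON THE GAUGE PARAMETERS IN `L²`, A UNITARY** (RULING №18's `τ` on `SiteL2K`). [cite: Balaban1985BackgroundPropagators, (3.21) p.394] -/
def tauS (c : B7Prop1Explicit.Site (F.P K).d) : SiteL2K ℂ 3 (periodsT3 F K) c₀ W₂ ≃ₗᵢ[ℂ] SiteL2K ℂ 3 (periodsT3 F K) c₀ W₂ :=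
  (tauSₗ F K c₀ c).isometryOfInner (inner_tauSₗ c)

/-- ★ **`τ(c)` — THE LATTICE TRANSLATION ON THE VECTOR FIELDS IN `L²`, A UNITARY** (RULING №18's `τ` on `BondL2K`). [cite: Balaban1985BackgroundPropagators, (3.11) p.392] -/
def tauB (c : B7Prop1Explicit.Site (F.P K).d) : BondL2K ℂ 3 (periodsT3 F K) c₀ W₂ ≃ₗᵢ[ℂ] BondL2K ℂ 3 (periodsT3 F K) c₀ W₂ :=
  (tauBₗ F K c₀ c).isometryOfInner (inner_tauBₗ c)

variable {F K c₀}

/-- `tauS c (toL2S f) = toL2S (siteTransl c f)`. [cite: Balaban1985BackgroundPropagators, (3.21) p.394] -/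
@[simp] theorem tauS_toL2S (c : B7Prop1Explicit.Site (F.P K).d) (f : Site (F.P K) 0 → Matrix (Fin 2) (Fin 2) ℂ) :
    tauS F K c₀ c (toL2S F K c₀ f) = toL2S F K c₀ (siteTransl F K c f) :=
  tauSₗ_toL2S c f

/-- `tauB c (toL2 X) = toL2 (bondTransl c X)`. [cite: Balaban1985BackgroundPropagators, (3.11) p.392] -/
@[simp] theorem tauB_toL2 (c : B7Prop1Explicit.Site (F.P K).d) (X : PBond (F.P K) 0 → Matrix (Fin 2) (Fin 2) ℂ) :
    tauB F K c₀ c (toL2 F K c₀ X) = toL2 F K c₀ (bondTransl F K c X) :=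
  tauBₗ_toL2 c X

end Summit.QuantumFields.YangMills.Theorems.Prop7CombTranslate

/-! ## §4 The route's half-block vector -/

namespace Summit.QuantumFields.YangMills.Theorems.Prop7CombTranslate

open Literature.MathematicalPhysics.QuantumFieldTheory.Balaban1983to89
open Literature.MathematicalPhysics.QuantumFieldTheory.Balaban1983to89.T3ContinuumYM3Torus
open Summit.QuantumFields.YangMills.Theorems.Prop7SPrint (basePt)

/-- **THE HALF-BLOCK VECTOR OF THE ROUTE**: the integer labels of the base point `x₀ = basePt F n K = embIter (K−n) 0`, i.e. `(L^{K−n}−1)∕2` on every axis (lit `TorusGeometry.val_emb`) —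
the `c` of RULING №18 («τ := the lattice translation by `c·(1,1,1)`»). [cite: Balaban1987RG1, (0.1) p.251; Balaban1985Averaging, (85)–(87) p.31] -/
def halfBlockVec (F : T3Family) (n K : ℕ) : B7Prop1Explicit.Site (F.P K).d := fun μ => (((basePt F n K μ).val : ℕ) : ℤ)

/-- unfolding. [cite: Balaban1987RG1, (0.1) p.251] -/
theorem halfBlockVec_apply (F : T3Family) (n K : ℕ) (μ : Fin (F.P K).d) : halfBlockVec F n K μ = (((basePt F n K μ).val : ℕ) : ℤ) := rfl

end Summit.QuantumFields.YangMills.Theorems.Prop7CombTranslate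

end
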